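import Summits.NavierStokesRegularity.FunctionalMining.TopEigProjectorDeriv
import HarnessLib

/-!
# FunctionalMining — Lemma L-λ, brick (ii′): on the top-gap class the field `M = λ₁ · (e₁ ⊗ e₁)` has
# `∑ᵢⱼ (∂ₖMᵢⱼ)² ≤ (2/η²) |S(∂ₖv) e₁|²` at every simple point

Search for candidate a priori estimates; no regularity claim. Cell `pub-nsfunc`, prove seat
(gen 25). Sequel of `TopEigColumnCharge` / `TopEigFrameDeriv` / `TopEigProjectorDeriv` toward the
dictionary's node `TopEigGapCoerciveTwo η` (Proposition L-λ(η), no-go seat SIEVELD §3.4b (4), pen): the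
pen proof's matrix field `M := λ₁ e₁ ⊗ e₁ = λ₁ · topProj` and the pointwise control of its gradient by
the `e₁`-column of `∇S` on the class `λ₂ ≤ (1 − η)λ₁`:

* `hasDerivAt_topEig_coordLine` — along `t ↦ x + t eₖ` through `x ∈ U_s`, `λ₁` has derivative
  `u₀ᵀS(∂ₖv)(x)u₀` at `0` (Hellmann–Feynman, as a `HasDerivAt`; the tree's
  `partialDeriv_partialDeriv_torusStrainTopEig_eq_sum_frame` records the value);
* **`sum_sq_partialDeriv_lamProj_le_of_gap`** — for `v` smooth and divergence free, `0 < η ≤ 1`,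
  `x ∈ U_s` with `λ₂(x) ≤ (1 − η)λ₁(x)`, and every direction `k`:
  `∑ᵢⱼ (∂ₖ (λ₁ · topProj)ᵢⱼ (x))² ≤ (2/η²) · |S(∂ₖv)(x) u₀|²`
  (`∂ₖ(λ₁P) = (∂ₖλ₁)P + λ₁∂ₖP`, `|P| = 1`, `P ⊥ ∂ₖP`, `|∂ₖP|² = 2|N′|² ≤ 2(ηλ₁)⁻²∑_{a≠a₀}(u_aᵀSₖu₀)²`,
  and `(∂ₖλ₁)² = (u₀ᵀSₖu₀)²`; Parseval).

With `TopEigColumnCharge` (`T₂ ≥ (4/3)∫∑ₖ|Sₖu₀|²`) this gives `∑ₖ∫|∂ₖM|² ≤ (3/(2η²)) T₂(v)` on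
everywhere-simple fields of the class; the remaining steps of L-λ(η) are the Poincaré inequality for
`M` (columnwise `Torus.integral_norm_sq_le_gradNormSq_of_hasZeroMean`) with `∫ S = 0`, `∫λ₁² = ∫ S:M`,
and the zeros of `S` (DERIVATIVES §46.4). Nothing about L-λ itself is claimed. [ours]
-/

noncomputable section

open Filter Topology Matrix Finset
open scoped ContDiff

namespace Summit.NavierStokesRegularity.FunctionalMining

open Literature.Analysis Literature.Analysis.FunctionSpaces Literature.Analysis.FunctionSpaces.Torus
  SharpClass.DirectorForm Literature.Analysis.Matrix

namespace TopEig

variable {v : UnitAddTorus (Fin 3) → EuclideanSpace ℝ (Fin 3)}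

/-- **Hellmann–Feynman along a coordinate line, as a derivative**: at `x ∈ U_s` with top index `a₀`,
`t ↦ λ₁(x + t eₖ)` has derivative `u₀ᵀ S(∂ₖv)(x) u₀` at `t = 0`. [ours; F1 PART I Prop. 3] -/
theorem hasDerivAt_topEig_coordLine (hv : Torus.IsSmooth v)
    {x : UnitAddTorus (Fin 3)} (hx : torusStrainMidEig v x < torusStrainTopEig v x) {a₀ : Fin 3}
    (ha₀ : (torusStrainMatrix_isHermitian v x).eigenvalues a₀ = torusStrainTopEig v x) (k : Fin 3) :
    HasDerivAt (fun t : ℝ => torusStrainTopEig v (x + proj (t • EuclideanSpace.single k (1 : ℝ))))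
      (((torusStrainMatrix_isHermitian v x).eigenvectorBasis a₀).ofLp ⬝ᵥ
        (torusStrainMatrix (Torus.partialDeriv k v) x *ᵥ
          ((torusStrainMatrix_isHermitian v x).eigenvectorBasis a₀).ofLp)) (0 : ℝ) := by
  obtain ⟨he1, hSe, hgap⟩ := gapForm_eigenvectorBasis hx ha₀
  set e : Fin 3 → ℝ := ((torusStrainMatrix_isHermitian v x).eigenvectorBasis a₀).ofLp with hedef
  have hg : 0 < torusStrainTopEig v x - torusStrainMidEig v x := sub_pos.2 hx
  set K : EuclideanSpace ℝ (Fin 3) := EuclideanSpace.single k (1 : ℝ) with hK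
  set L : ℝ → Matrix (Fin 3) (Fin 3) ℝ := fun t => torusStrainMatrix v (x + proj (t • K)) with hL
  have hLs : ∀ i j, ContDiff ℝ ∞ fun t => L t i j := fun i j =>
    contDiff_coordLine (isSmooth_torusStrainMatrix_entry hv i j) x K
  have hLsymm : ∀ t, (L t).IsSymm := fun t => torusStrainMatrix_isSymm v _
  have hL0 : L 0 = torusStrainMatrix v x := by simp only [hL, coordLine_zero]
  have hSe' : L 0 *ᵥ e = torusStrainTopEig v x • e := by rw [hL0]; exact hSe
  have hgap' : ∀ w, w ⬝ᵥ e = 0 → w ⬝ᵥ L 0 *ᵥ w ≤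
      (torusStrainTopEig v x - (torusStrainTopEig v x - torusStrainMidEig v x)) * (w ⬝ᵥ w) := by
    intro w hw; rw [hL0]; exact hgap w hw
  obtain ⟨N, Λ, hN, hΛ, hN0, hΛ0, hev, hHF, -, -, -⟩ :=
    hasDerivAt_top_eigenpair hLs hLsymm he1 hSe' hg hgap'
  have hpers := eventually_top_eigenpair hLs hLsymm he1 hSe' hg hgap' hN hΛ hN0 hΛ0 hev
  have heq : (fun θ => lam1 (L θ)) =ᶠ[𝓝 0] Λ := hpers.mono fun θ h => h.1
  have hD1 := hHF.congr_of_eventuallyEq heq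
  have hd1 : ∀ i j, deriv (fun t => L t i j) 0 = torusStrainMatrix (Torus.partialDeriv k v) x i j := by
    intro i j
    have h := hasDerivAt_coordLine (isSmooth_torusStrainMatrix_entry hv i j) x k 0
    rw [coordLine_zero, partialDeriv_strainEntry hv] at h
    exact h.deriv
  have hM1 : (Matrix.of fun i j => deriv (fun t => L t i j) 0) =
      torusStrainMatrix (Torus.partialDeriv k v) x := by
    ext i j; rw [Matrix.of_apply, hd1]
  rw [hM1] at hD1
  have hfun : (fun t => lam1 (L t)) = fun t => torusStrainTopEig v (x + proj (t • K)) := by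
    funext t; exact lam1_torusStrainMatrix v _
  rw [hfun] at hD1
  exact hD1

/-- **On the top-gap class, `∑ᵢⱼ (∂ₖ(λ₁ · P₁)ᵢⱼ)² ≤ (2/η²)|S(∂ₖv)u₀|²` at every simple point.** For
`v` smooth and divergence free on `T³`, `0 < η ≤ 1`, `x ∈ U_s` with `λ₂(x) ≤ (1−η)λ₁(x)`, top index
`a₀` and a direction `k`:
`∑ᵢⱼ (∂ₖ (y ↦ λ₁(y)·(topProj v y)ᵢⱼ) (x))² ≤ (2/η²) · |S(∂ₖv)(x) u₀|²`. [ours] -/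
theorem sum_sq_partialDeriv_lamProj_le_of_gap (hv : Torus.IsSmooth v) (hdiv : Torus.IsDivFree v)
    {η : ℝ} (hη0 : 0 < η) (hη1 : η ≤ 1)
    {x : UnitAddTorus (Fin 3)} (hx : torusStrainMidEig v x < torusStrainTopEig v x)
    (hgapx : torusStrainMidEig v x ≤ (1 - η) * torusStrainTopEig v x) {a₀ : Fin 3}
    (ha₀ : (torusStrainMatrix_isHermitian v x).eigenvalues a₀ = torusStrainTopEig v x) (k : Fin 3) :
    ∑ i, ∑ j, (Torus.partialDeriv k (fun y => torusStrainTopEig v y * topProj v y i j) x) ^ 2 ≤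
      2 / η ^ 2 *
        ((torusStrainMatrix (Torus.partialDeriv k v) x *ᵥ
            ((torusStrainMatrix_isHermitian v x).eigenvectorBasis a₀).ofLp) ⬝ᵥ
          (torusStrainMatrix (Torus.partialDeriv k v) x *ᵥ
            ((torusStrainMatrix_isHermitian v x).eigenvectorBasis a₀).ofLp)) := by
  obtain ⟨he1, hSe, hgap⟩ := gapForm_eigenvectorBasis hx ha₀
  set e : Fin 3 → ℝ := ((torusStrainMatrix_isHermitian v x).eigenvectorBasis a₀).ofLp with hedef
  set M : Matrix (Fin 3) (Fin 3) ℝ := torusStrainMatrix (Torus.partialDeriv k v) x with hMdef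
  set lam : ℝ := torusStrainTopEig v x with hlam
  have hg : 0 < torusStrainTopEig v x - torusStrainMidEig v x := sub_pos.2 hx
  have hlam0 : 0 < lam := (lam_pos_of_gapForm_of_isDivFree hv hdiv he1 hSe hg hgap).2
  obtain ⟨N', hder, h0, hnorm⟩ := hasDerivAt_topProj_coordLine hv hx ha₀ k
  have hHF1 := hasDerivAt_topEig_coordLine hv hx ha₀ k
  set a : ℝ := e ⬝ᵥ (M *ᵥ e) with hadef
  -- value of `topProj` at `x`: `e ⊗ e`
  have hP0 : ∀ i j, topProj v (x + proj ((0 : ℝ) • EuclideanSpace.single k (1 : ℝ))) i j = e i * e j := by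
    intro i j
    rw [coordLine_zero]
    have hmem : topVec v x ∈ topEigSet (flat (torusStrainMatrix v x)) := topVec_mem_topEigSet v x
    have he1' : e ∈ unitSphere (Fin 3) := he1
    have hquad : quad (flat (torusStrainMatrix v x)) e = lam := by
      rw [quad_flat, hSe, dotProduct_smul, he1, smul_eq_mul, mul_one]
    have hpair := topEigSet_eq_pair_of_gapForm he1' hg
      (gapForm_of_eigenvector (torusStrainMatrix_isSymm v x) he1' hSe hgap) hquad
    rw [hpair] at hmem
    show Matrix.vecMulVec (topVec v x) (topVec v x) i j = e i * e j
    rw [vecMulVec_eq_of_mem_pair hmem, Matrix.vecMulVec_apply]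
  have hlam0' : torusStrainTopEig v (x + proj ((0 : ℝ) • EuclideanSpace.single k (1 : ℝ))) = lam := by
    rw [coordLine_zero]
  -- the derivative of each entry of `λ₁ · P`
  have hpd : ∀ i j, Torus.partialDeriv k (fun y => torusStrainTopEig v y * topProj v y i j) x =
      a * (e i * e j) + lam * (N' i * e j + e i * N' j) := by
    intro i j
    have h := hHF1.mul (hder i j)
    rw [hP0 i j, hlam0'] at h
    exact h.deriv
  simp_rw [hpd]
  -- expand the square: `|P| = 1`, `P ⊥ P′`, `|P′|² = 2|N′|²`
  have hsq : ∑ i, ∑ j, (a * (e i * e j) + lam * (N' i * e j + e i * N' j)) ^ 2 =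
      a ^ 2 + 2 * lam ^ 2 * (N' ⬝ᵥ N') := by
    have hexp : ∀ i j, (a * (e i * e j) + lam * (N' i * e j + e i * N' j)) ^ 2 =
        a ^ 2 * ((e i * e i) * (e j * e j)) + lam ^ 2 * (N' i * e j + e i * N' j) ^ 2 +
          2 * a * lam * ((e i * N' i) * (e j * e j) + (e i * e i) * (e j * N' j)) := by
      intro i j; ring
    simp_rw [hexp, Finset.sum_add_distrib, ← Finset.mul_sum, ← Finset.sum_mul]
    have h1 : ∑ j, e j * e j = 1 := by simpa [dotProduct] using he1
    have h2 : ∑ i, e i * N' i = 0 := by simpa [dotProduct, mul_comm] using h0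
    have hcross : ∑ i, ∑ j, (e i * N' i * (e j * e j) + e i * e i * (e j * N' j)) = 0 := by
      have hin : ∀ i, ∑ j, (e i * N' i * (e j * e j) + e i * e i * (e j * N' j)) =
          e i * N' i * (∑ j, e j * e j) + e i * e i * (∑ j, e j * N' j) := fun i => by
        rw [Finset.sum_add_distrib, Finset.mul_sum, Finset.mul_sum]
      simp_rw [hin, h1, h2, mul_one, mul_zero, add_zero]
      exact h2
    rw [sum_sq_projDeriv_eq he1 h0, h1, hcross]
    ring
  rw [hsq, hnorm]
  -- the gap bound on `|N′|²` with `γ = η λ₁`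
  have hB := sum_sq_partialDeriv_topProj_le_of_gap hv hx ha₀ k (γ := η * lam) (mul_pos hη0 hlam0)
    (fun b hb => by
      have hle := eigenvalues_le_midEig_of_ne hx ha₀ hb
      show η * lam ≤ torusStrainTopEig v x - (torusStrainMatrix_isHermitian v x).eigenvalues b
      nlinarith)
  rw [sum_sq_partialDeriv_topProj_eq hv hx ha₀ k] at hB
  -- `a² ≤ |Me|²_{a₀-part}` and assemble with Parseval
  have hpars : (M *ᵥ e) ⬝ᵥ (M *ᵥ e) =
      a ^ 2 + ∑ b ∈ Finset.univ.erase a₀,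
        (((torusStrainMatrix_isHermitian v x).eigenvectorBasis b).ofLp ⬝ᵥ (M *ᵥ e)) ^ 2 := by
    rw [← sum_sq_frame_eq_column_sq x M e, ← Finset.add_sum_erase _ _ (Finset.mem_univ a₀)]
  set B : ℝ := ∑ b ∈ Finset.univ.erase a₀,
    (((torusStrainMatrix_isHermitian v x).eigenvectorBasis b).ofLp ⬝ᵥ (M *ᵥ e)) ^ 2 with hBdef
  set W : ℝ := ∑ b ∈ Finset.univ.erase a₀,
    ((((torusStrainMatrix_isHermitian v x).eigenvectorBasis b).ofLp ⬝ᵥ (M *ᵥ e)) /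
      (torusStrainTopEig v x - (torusStrainMatrix_isHermitian v x).eigenvalues b)) ^ 2 with hWdef
  have hB0 : 0 ≤ B := Finset.sum_nonneg fun b _ => sq_nonneg _
  have ha0 : 0 ≤ a ^ 2 := sq_nonneg _
  -- `hB : 2 W ≤ 2 (ηλ)⁻² |Me|²`; we need `2 λ² W ≤ (2/η²) B`-type control: use the finer termwise bound
  have hW : W ≤ ((η * lam) ^ 2)⁻¹ * B := by
    rw [hWdef, hBdef, Finset.mul_sum]
    refine Finset.sum_le_sum fun b hb => ?_
    have hne : b ≠ a₀ := (Finset.mem_erase.1 hb).1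
    have hle := eigenvalues_le_midEig_of_ne hx ha₀ hne
    have hga : η * lam ≤ torusStrainTopEig v x - (torusStrainMatrix_isHermitian v x).eigenvalues b := by
      nlinarith
    rw [div_pow, div_eq_mul_inv, mul_comm]
    refine mul_le_mul_of_nonneg_right ?_ (sq_nonneg _)
    exact inv_anti₀ (pow_pos (mul_pos hη0 hlam0) 2) (pow_le_pow_left₀ (mul_pos hη0 hlam0).le hga 2)
  have hη2 : 0 < η ^ 2 := pow_pos hη0 2
  have hkey : 2 * lam ^ 2 * W ≤ 2 / η ^ 2 * B := by
    have h1 : 2 * lam ^ 2 * W ≤ 2 * lam ^ 2 * (((η * lam) ^ 2)⁻¹ * B) :=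
      mul_le_mul_of_nonneg_left hW (by positivity)
    have e1 : 2 * lam ^ 2 * (((η * lam) ^ 2)⁻¹ * B) = 2 / η ^ 2 * B := by
      have hl : lam ≠ 0 := hlam0.ne'
      field_simp
    linarith
  have hcoef : (1 : ℝ) ≤ 2 / η ^ 2 := by
    rw [le_div_iff₀ hη2]; nlinarith
  rw [hpars]
  calc a ^ 2 + 2 * lam ^ 2 * W ≤ 2 / η ^ 2 * a ^ 2 + 2 / η ^ 2 * B := by nlinarith
    _ = 2 / η ^ 2 * (a ^ 2 + B) := by ring

end TopEig

end Summit.NavierStokesRegularity.FunctionalMining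

end
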